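import Mathlib
import HarnessLib
import Summits.HubbardSuperconductivity.HubbardSuperconductivity.Theorems.KLProgrammeKLRegimeThinIncrementFlowPieceData
import Summits.HubbardSuperconductivity.HubbardSuperconductivity.Theorems.KLProgrammeKLRegimeAlphaWtFlowDeep
import Summits.HubbardSuperconductivity.HubbardSuperconductivity.Theorems.KLProgrammeKLRegimeEngineIsoTupleV17FDoor
import Summits.HubbardSuperconductivity.HubbardSuperconductivity.Theorems.KLProgrammeKLRegimeSplitTwoLegReadJetsStruct
import Summits.HubbardSuperconductivity.HubbardSuperconductivity.Theorems.KLProgrammeKLRegimeFrameOKDerivBounds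

/-!
# K3 VL child `KLRegimeVolumeLimitV17F2` (stmt-HubbardSuperconductivity-20440), #23 «W2-HALF-VL», brick «W2H-OVL» part 21 (FLOW DATA): the frame class of two
# consecutive flow frames `K_i, K_{i+1}` and the two-scale data of their band increment, read off the history `HistP klPredsV17F2 … 0 n` (`1 ≤ i`, `i + 1 ≤ n`)

Cell `gate-hubbard-kl`, seat p3 (g15), lead of #23.  The «W2H-OVL» regime file instantiates `charSumWt_thinPairDiff_le_piece` (part 19) at
`(K, K′) = (K_i, K_{i+1})`, `K_m = klFlowFrameU L M β U μ m`; this file collects the frame-class inputs by name: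

* `thinPair_flow_frames` — `FrameOK R U (nScales β) μ K_i`, `FrameOK R U (nScales β) μ K_{i+1}` (for the `C²` sizes), the third sizes
  `‖D³ frameShift K_i‖ ≤ Gfr₃U²·4^i/3`, `‖D³ frameShift K_{i+1}‖ ≤ Gfr₃U²·4^{i+1}/3` (`frameShift_high_sizes_of_frameOK` at the sharp indices), the curvatures
  `‖D² frameLevel μ K‖ ≤ 7` of both, the piece's jets `FlowPieceJetsAt L M β U μ R i` and `frameDist K_i K_{i+1} ≤ Gfr₀|U|·4^{−2i}`;
* `thinPair_flow_piece` — the band increment `ν = e_{K_i} − e_{K_{i+1}}` (Pi side) in the normalisation of the rate atoms: `ContDiff ℝ 3 ν`,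
  `|ν| ≤ G₀/x²`, `‖Dν‖ ≤ 2G₀/x`, `‖D²ν‖ ≤ 4G₀`, `‖D³ν‖ ≤ 8G₀·x` with `x = 4^i` and ANY `G₀ ≥ (Gfr₀ + Gfr₁ + Gfr₂ + Gfr₃)·|U|`, `|U| ≤ 1`
  (so that the ratios `G_k/G₀ ∈ {2, 4, 8}` are U-free), and `frameDist K_i K_{i+1} ≤ G₀/x²`.

No definitions, no sorry.  Nothing asserts any stub, K3, VL or superconductivity. [cite: BenfattoGiulianiMastropietro2006, §3 (3.2)]
-/

noncomputable section

namespace Summit.HubbardSuperconductivity.HubbardSuperconductivity.Theorems.TorusFourierL2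

set_option linter.dupNamespace false -- summit = problem name (single-conjunct summit), D-0017

open Set Finset Literature.MathematicalPhysics.QuantumLattice Literature.MathematicalPhysics.QuantumLattice.BandSectorCounting
open Literature.MathematicalPhysics.QuantumLattice.FermiRG Literature.Probability.LatticeModels
open Summit.HubbardSuperconductivity.HubbardSuperconductivity.Theorems.DispersionFlow
open Summit.HubbardSuperconductivity.HubbardSuperconductivity.Theorems.KLRegimeSplit
open Summit.HubbardSuperconductivity.HubbardSuperconductivity.Theorems.KLProgrammeLegKernels
open Summit.HubbardSuperconductivity.HubbardSuperconductivity.Theorems.PerturbedFermiCurve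
open scoped Real

variable {L M : ℕ} [NeZero L] [NeZero M]

/-- **The frame class of two consecutive flow frames from the history** (see the module docstring). [cite: BenfattoGiulianiMastropietro2006, §3 (3.2)] -/
theorem thinPair_flow_frames {G : GeoConsts} {P : SplitConsts} {Q : EngConsts} {R : RenConsts} (hR2 : R.WF2) {β U μ : ℝ} {n : ℕ}
    (hnN : n ≤ nScales β + 1) (hhist : HistP klPredsV17F2 L M G P Q R β U μ 0 n) {i : ℕ} (hi1 : 1 ≤ i) (hin : i + 1 ≤ n) :
    FrameOK R U (nScales β) μ (klFlowFrameU L M β U μ i) ∧ FrameOK R U (nScales β) μ (klFlowFrameU L M β U μ (i + 1)) ∧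
      (∀ p : Momentum, ‖iteratedFDeriv ℝ 3 (frameShift (klFlowFrameU L M β U μ i)) p‖ ≤ R.Gfr 3 * U ^ 2 * ((4 : ℝ) ^ i / 3)) ∧
      (∀ p : Momentum, ‖iteratedFDeriv ℝ 3 (frameShift (klFlowFrameU L M β U μ (i + 1))) p‖ ≤ R.Gfr 3 * U ^ 2 * ((4 : ℝ) ^ (i + 1) / 3)) ∧
      (∀ p : Momentum, ‖iteratedFDeriv ℝ 2 (frameLevel μ (klFlowFrameU L M β U μ i)) p‖ ≤ 7) ∧
      (∀ p : Momentum, ‖iteratedFDeriv ℝ 2 (frameLevel μ (klFlowFrameU L M β U μ (i + 1))) p‖ ≤ 7) ∧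
      FlowPieceJetsAt L M β U μ R i ∧
      frameDist (klFlowFrameU L M β U μ i) (klFlowFrameU L M β U μ (i + 1)) ≤ R.Gfr 0 * |U| * ((4 : ℝ) ^ i)⁻¹ ^ 2 := by
  have hRj : ∀ j, 0 ≤ R.Gfr j := EngineV8.gfr_nonneg_of_wf2 hR2
  have hh := (histP_klPredsV17F2_iff L M G P Q R β U μ 0 n).1 hhist
  have hJ : ∀ m ≤ i, FlowPieceJetsAt L M β U μ R m := fun m hm => (hh m (by omega)).2.1.2.1
  obtain ⟨N, rfl⟩ : ∃ N, i = N + 1 := ⟨i - 1, by omega⟩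
  have hK1 : FrameOK R U N μ (klFlowFrameU L M β U μ (N + 1)) :=
    frameOK_klFlowFrameU_succ (fun m hm => hJ m (by omega)) (hh N (by omega)).2.1.2.2
  have hK2 : FrameOK R U (N + 1) μ (klFlowFrameU L M β U μ (N + 1 + 1)) :=
    frameOK_klFlowFrameU_succ (fun m hm => hJ m hm) (hh (N + 1) (by omega)).2.1.2.2
  have hfr1 : FrameOK R U (nScales β) μ (klFlowFrameU L M β U μ (N + 1)) := FrameOK.mono hRj (by omega) hK1
  have hfr2 : FrameOK R U (nScales β) μ (klFlowFrameU L M β U μ (N + 1 + 1)) := FrameOK.mono hRj (by omega) hK2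
  refine ⟨hfr1, hfr2, (frameShift_high_sizes_of_frameOK hRj hK1).1, (frameShift_high_sizes_of_frameOK hRj hK2).1,
    fun p => norm_iteratedFDeriv_two_frameLevel_le_of_frameOK hK1 p, fun p => norm_iteratedFDeriv_two_frameLevel_le_of_frameOK hK2 p,
    hJ (N + 1) le_rfl, ?_⟩
  have h := frameDist_klFlowFrameU_succ_le (L := L) (M := M) (β := β) (U := U) (μ := μ) (R := R) (j := N + 1) (fun m hm => hJ m (by omega))
  rw [frameDist_comm] at h
  refine h.trans (le_of_eq ?_)
  have hu : uPow 0 U = |U| := by simp [uPow]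
  rw [hu, show (((0 : ℕ) : ℤ) - 2) * ((N + 1 : ℕ) : ℤ) = -(((N + 1) * 2 : ℕ) : ℤ) by push_cast; ring, zpow_neg, zpow_natCast, pow_mul,
    ← inv_pow]

/-- **The band increment of one flow piece in the rate atoms' normalisation**: for `ν = e_{K_i} − e_{K_{i+1}}` (Pi side), `x = 4^i`, `|U| ≤ 1` and any
`G₀ ≥ (Gfr₀ + Gfr₁ + Gfr₂ + Gfr₃)·|U|`: `ContDiff ℝ 3 ν`, `|ν| ≤ G₀/x²`, `‖Dν‖ ≤ 2G₀/x`, `‖D²ν‖ ≤ 4G₀`, `‖D³ν‖ ≤ 8G₀·x`, and `frameDist K_i K_{i+1} ≤ G₀/x²`.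
[cite: BenfattoGiulianiMastropietro2006, §3 (3.2)] -/
theorem thinPair_flow_piece {β U μ : ℝ} {R : RenConsts} (hRj : ∀ j, 0 ≤ R.Gfr j) (hU1 : |U| ≤ 1) {i : ℕ}
    (hJ : ∀ m ≤ i, FlowPieceJetsAt L M β U μ R m) {x : ℝ} (hx : x = (4 : ℝ) ^ i) {G₀ : ℝ}
    (hG : (R.Gfr 0 + R.Gfr 1 + R.Gfr 2 + R.Gfr 3) * |U| ≤ G₀) {ν : (Fin 2 → ℝ) → ℝ}
    (hν : ∀ p, ν p = frameLevel μ (klFlowFrameU L M β U μ i) (WithLp.toLp 2 p) - frameLevel μ (klFlowFrameU L M β U μ (i + 1)) (WithLp.toLp 2 p)) :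
    ContDiff ℝ 3 ν ∧ (∀ p, |ν p| ≤ G₀ / x ^ 2) ∧ (∀ p, ‖fderiv ℝ ν p‖ ≤ 2 * G₀ / x) ∧ (∀ p, ‖iteratedFDeriv ℝ 2 ν p‖ ≤ 4 * G₀) ∧
      (∀ p, ‖iteratedFDeriv ℝ 3 ν p‖ ≤ 8 * G₀ * x) ∧ frameDist (klFlowFrameU L M β U μ i) (klFlowFrameU L M β U μ (i + 1)) ≤ G₀ / x ^ 2 := by
  obtain ⟨hC, h0, h1, h2, h3⟩ := thinIncr_flowPieceData_neg (L := L) (M := M) (hJ i le_rfl) hν hx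
  have hx0 : 0 < x := by rw [hx]; positivity
  have hU0 : 0 ≤ |U| := abs_nonneg U
  have hU2 : U ^ 2 ≤ |U| := by rw [← sq_abs]; nlinarith only [hU0, hU1]
  have hu0 : uPow 0 U = |U| := by simp [uPow]
  have hu : ∀ j, 1 ≤ j → uPow j U = U ^ 2 := fun j hj => by simp [uPow, show j ≠ 0 by omega]
  have h0' := hRj 0; have h1' := hRj 1; have h2' := hRj 2; have h3' := hRj 3
  have hG0 : R.Gfr 0 * |U| ≤ G₀ := by nlinarith only [hG, h1', h2', h3', hU0]
  have hG1 : R.Gfr 1 * U ^ 2 ≤ G₀ := by nlinarith only [hG, h0', h1', h2', h3', hU0, hU2]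
  have hG2 : R.Gfr 2 * U ^ 2 ≤ G₀ := by nlinarith only [hG, h0', h1', h2', h3', hU0, hU2]
  have hG3 : R.Gfr 3 * U ^ 2 ≤ G₀ := by nlinarith only [hG, h0', h1', h2', h3', hU0, hU2]
  refine ⟨hC, fun p => ?_, fun p => ?_, fun p => ?_, fun p => ?_, ?_⟩
  · refine (h0 p).trans ?_
    rw [hu0]; exact div_le_div_of_nonneg_right hG0 (by positivity)
  · refine (h1 p).trans ?_
    rw [hu 1 le_rfl]
    have e : 2 * (R.Gfr 1 * U ^ 2) / x = 2 * (R.Gfr 1 * U ^ 2 / x) := by ring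
    have e' : 2 * G₀ / x = 2 * (G₀ / x) := by ring
    rw [e, e']
    exact mul_le_mul_of_nonneg_left (div_le_div_of_nonneg_right hG1 hx0.le) (by norm_num : (0 : ℝ) ≤ 2)
  · refine (h2 p).trans ?_
    rw [hu 2 (by norm_num)]; linarith only [hG2]
  · refine (h3 p).trans ?_
    rw [hu 3 (by norm_num)]
    exact mul_le_mul_of_nonneg_right (by linarith only [hG3]) hx0.le
  · have h := frameDist_klFlowFrameU_succ_le (L := L) (M := M) (β := β) (U := U) (μ := μ) (R := R) (j := i) (fun m hm => hJ m (by omega))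
    rw [frameDist_comm] at h
    refine h.trans ?_
    have e : (4 : ℝ) ^ ((((0 : ℕ) : ℤ) - 2) * (i : ℤ)) = 1 / x ^ 2 := by
      rw [hx, show (((0 : ℕ) : ℤ) - 2) * (i : ℤ) = -((i * 2 : ℕ) : ℤ) by push_cast; ring, zpow_neg, zpow_natCast, pow_mul, one_div]
    rw [e, hu0, ← mul_div_assoc, mul_one]
    exact div_le_div_of_nonneg_right hG0 (by positivity)

end Summit.HubbardSuperconductivity.HubbardSuperconductivity.Theorems.TorusFourierL2

end
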